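import Summits.CriticalPhenomena.PercolationContinuityZ3.Theorems.Transplant.SkelPhiCorridorKGBoxes
import HarnessLib

/-!
# N2 (frames-only node `SamePDropOfSkeletonFrm₁`, OPEN), (C)/(R) corridor slots: **THE SECOND-AXIS K-G CORRIDOR VALUES ARE MONOTONE IN THE RUN
# LENGTH** (integers only) — `Skelφ.kgT₁Y_mono / KGYRows.kgM₁Y_mono / KGYRows.kgTY_mono / KGYRows.kgM₂Y_mono / KGYRows.kgXY_mono / KGYRows.sLY_pos /
# KGYRows.kgFarY_mono / KGYRows.kgZY₁_mono / KGYRows.kgZY₀_le_of_le / KGYRows.kgSchedLenY_mono` (the twin of SkelPhiCorridorKGMono for the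
# `y′`-corridor `Skelφ.kgCorrSchedY`).
Why ((R) column second axis, lane INBOX 2026-08-23T11:32:57Z p3-g17): the root's `y′`-corridor starts at the second landing vertex `c₂` (over the x-prefix's
last core), so it runs at its own length `N_Ry ≤ kgNYv0`; every bound proved AT `kgNYv0` transfers to the shorter run by the lemmas here.  Cell-free and
window-generic (no ledger names).
builds on p205010 (kernel theorem, internal audit signed; external expert review pending) — nothing in this file uses p205010; nothing here is a
claim about the open node `SamePDropOfSkeletonFrm₁`.
Lane `prim-bschramm`, seat `prim-bschramm-p3` (gen 17; (R) lineage); helper file (`--supports stmt-CriticalPhenomena-4575 --as helper`).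
[cite: KozmaNitzan2024, §4 Lemma 12 (pp. 23–25: the target box of a corridor)] [cite: MartineauTassion2017, §4.3 Lemma 4.2 (steering)]
-/

namespace Summit.CriticalPhenomena.PercolationContinuityZ3.Theorems.Transplant

namespace Skelφ

open Literature.Probability.Percolation Literature.Probability.LatticeModels SimpleGraph
open ChainPlanar ChainPara

section KGYMono

variable {n ℓ : ℕ} {hs v : ℤ} {R' ρ q W : ℕ}

/-- `T₁Y = 2W + 2(N+1)R′ − 2|v|` is monotone in the run length `N`. [this work] -/
theorem kgT₁Y_mono (v : ℤ) (R' W : ℕ) {N N' : ℕ} (h : N ≤ N') : kgT₁Y v R' W N ≤ kgT₁Y v R' W N' := by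
  unfold kgT₁Y
  have hN : (N : ℤ) ≤ N' := by exact_mod_cast h
  have hR : (0 : ℤ) ≤ R' := by positivity
  nlinarith

/-- **`m₁Y` is monotone in `N`** (`m₁Y + 1 = ⌊T₁Y/dec₁Y⌋`, `dec₁Y > 0`). [this work] -/
theorem KGYRows.kgM₁Y_mono (H : KGYRows n ℓ hs v R' ρ q W) {N N' : ℕ} (h : N ≤ N') :
    kgM₁Y n v R' ρ W N ≤ kgM₁Y n v R' ρ W N' := by
  have hd : 0 < kgDec₁Y n R' ρ := by
    have := H.dec₁_pos.1; have : (0 : ℤ) ≤ R' := by positivity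
    have : (0 : ℤ) ≤ ρ := by positivity
    linarith
  unfold kgM₁Y
  have hdiv : kgT₁Y v R' W N / kgDec₁Y n R' ρ ≤ kgT₁Y v R' W N' / kgDec₁Y n R' ρ := Int.ediv_le_ediv hd (kgT₁Y_mono v R' W h)
  exact Nat.sub_le_sub_right (Int.toNat_le_toNat hdiv) 1

/-- **`TY = 2(q + (N+1)R′) + (N+1)dS + 2(m₁Y+1)(R′+ρ)` is monotone in `N`.** [this work] -/
theorem KGYRows.kgTY_mono (H : KGYRows n ℓ hs v R' ρ q W) {N N' : ℕ} (h : N ≤ N') :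
    kgTY n ℓ hs v R' ρ q W N ≤ kgTY n ℓ hs v R' ρ q W N' := by
  have hm : ((kgM₁Y n v R' ρ W N : ℕ) : ℤ) ≤ (kgM₁Y n v R' ρ W N' : ℕ) := by exact_mod_cast H.kgM₁Y_mono h
  unfold kgTY
  have hN : (N : ℤ) ≤ N' := by exact_mod_cast h
  have hR : (0 : ℤ) ≤ R' := by positivity
  have hρ : (0 : ℤ) ≤ ρ := by positivity
  have hd : (0 : ℤ) ≤ ((dS n ℓ hs : ℕ) : ℤ) := by positivity
  nlinarith

/-- **`m₂Y` is monotone in `N`** (`m₂Y + 1 = max 1 ⌈(TY − (P+ρ−1))/dec₂Y⌉`, `dec₂Y > 0`). [this work] -/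
theorem KGYRows.kgM₂Y_mono (H : KGYRows n ℓ hs v R' ρ q W) {N N' : ℕ} (h : N ≤ N') :
    kgM₂Y n ℓ hs v R' ρ q W N ≤ kgM₂Y n ℓ hs v R' ρ q W N' := by
  have hd : 0 < kgDec₂Y n ℓ hs R' ρ := by
    have := H.dec₂_pos; have : (0 : ℤ) ≤ R' := by positivity
    have : (0 : ℤ) ≤ ρ := by positivity
    linarith
  unfold kgM₂Y
  have hT := H.kgTY_mono h
  have hdiv : (kgTY n ℓ hs v R' ρ q W N - ((n : ℤ) * ℓ / (shearUnit n hs : ℕ) + 1 + ρ - 1) + kgDec₂Y n ℓ hs R' ρ - 1) / kgDec₂Y n ℓ hs R' ρ ≤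
      (kgTY n ℓ hs v R' ρ q W N' - ((n : ℤ) * ℓ / (shearUnit n hs : ℕ) + 1 + ρ - 1) + kgDec₂Y n ℓ hs R' ρ - 1) / kgDec₂Y n ℓ hs R' ρ :=
    Int.ediv_le_ediv hd (by linarith)
  exact Nat.sub_le_sub_right (Int.toNat_le_toNat (max_le_max le_rfl hdiv)) 1

/-- **The arrival overshoot `XY = q + (N+1)R′ + (N+1)dS + (m₁Y+1)(R′+ρ) + (m₂Y+1)(R′+ρ)` is monotone in `N`.** [this work] -/
theorem KGYRows.kgXY_mono (H : KGYRows n ℓ hs v R' ρ q W) {N N' : ℕ} (h : N ≤ N') :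
    kgXY n ℓ hs v R' ρ q W N ≤ kgXY n ℓ hs v R' ρ q W N' := by
  have hm₁ : ((kgM₁Y n v R' ρ W N : ℕ) : ℤ) ≤ (kgM₁Y n v R' ρ W N' : ℕ) := by exact_mod_cast H.kgM₁Y_mono h
  have hm₂ : ((kgM₂Y n ℓ hs v R' ρ q W N : ℕ) : ℤ) ≤ (kgM₂Y n ℓ hs v R' ρ q W N' : ℕ) := by exact_mod_cast H.kgM₂Y_mono h
  unfold kgXY
  have hN : (N : ℤ) ≤ N' := by exact_mod_cast h
  have hR : (0 : ℤ) ≤ R' := by positivity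
  have hρ : (0 : ℤ) ≤ ρ := by positivity
  have hd : (0 : ℤ) ≤ ((dS n ℓ hs : ℕ) : ℤ) := by positivity
  nlinarith

/-- `sLY ≥ 6R′ + 3ρ + 2 > 0` under the rows (`dec₂Y = sLY − 2R′ − ρ ≥ 4R′ + 2ρ + 2`). [folklore] -/
theorem KGYRows.sLY_pos (H : KGYRows n ℓ hs v R' ρ q W) : 6 * (R' : ℤ) + 3 * ρ + 2 ≤ kgSLY n ℓ hs := by
  have := H.dec₂_pos
  unfold kgDec₂Y at this
  linarith

/-- **The arrival's far edge `(N+1)·sLY + XY` is monotone in `N`.** [this work] -/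
theorem KGYRows.kgFarY_mono (H : KGYRows n ℓ hs v R' ρ q W) {N N' : ℕ} (h : N ≤ N') :
    kgFarY n ℓ hs v R' ρ q W N ≤ kgFarY n ℓ hs v R' ρ q W N' := by
  have hX := H.kgXY_mono h
  have hsl := H.sLY_pos
  unfold kgFarY
  have hN : (N : ℤ) ≤ N' := by exact_mod_cast h
  have hR : (0 : ℤ) ≤ R' := by positivity
  have hρ : (0 : ℤ) ≤ ρ := by positivity
  have hs0 : 0 ≤ kgSLY n ℓ hs := by linarith
  nlinarith

/-- **The along (rows) half-extent `ZY₁` of the second-axis prism box (at the schedule's own `m₁Y, m₂Y`) is monotone in `N`.** [this work] -/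
theorem KGYRows.kgZY₁_mono (H : KGYRows n ℓ hs v R' ρ q W) {N N' : ℕ} (h : N ≤ N') :
    kgZY₁ n ℓ hs R' ρ q N (kgM₁Y n v R' ρ W N) (kgM₂Y n ℓ hs v R' ρ q W N) ≤
      kgZY₁ n ℓ hs R' ρ q N' (kgM₁Y n v R' ρ W N') (kgM₂Y n ℓ hs v R' ρ q W N') := by
  have hm₁ : ((kgM₁Y n v R' ρ W N : ℕ) : ℤ) ≤ (kgM₁Y n v R' ρ W N' : ℕ) := by exact_mod_cast H.kgM₁Y_mono h
  have hm₂ : ((kgM₂Y n ℓ hs v R' ρ q W N : ℕ) : ℤ) ≤ (kgM₂Y n ℓ hs v R' ρ q W N' : ℕ) := by exact_mod_cast H.kgM₂Y_mono h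
  unfold kgZY₁
  have hN : (N : ℤ) ≤ N' := by exact_mod_cast h
  have hR : (0 : ℤ) ≤ R' := by positivity
  have hρ : (0 : ℤ) ≤ ρ := by positivity
  have hd : (0 : ℤ) ≤ ((dS n ℓ hs : ℕ) : ℤ) := by positivity
  nlinarith

/-- **The across (`x′`) half-extent `ZY₀` at run length `N` is bounded in closed form at any `N′ ≥ N`** (`Wm₂Y + Wp₂Y = E₁Y < 2(n+|v|) + dec₁Y`):
`ZY₀(N) ≤ (N′+2)|v| + 2n + W + (N′+1)R′ + (2(n+|v|) + dec₁Y) + (m₁Y(N′) + m₂Y(N′) + 2)(R′+ρ+|v|) + R′`. [this work] -/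
theorem KGYRows.kgZY₀_le_of_le (H : KGYRows n ℓ hs v R' ρ q W) {N N' : ℕ} (h : N ≤ N') :
    kgZY₀ n v R' ρ W N (kgM₁Y n v R' ρ W N) (kgWm₂Y n v R' ρ W N) (kgWp₂Y n v R' ρ W N) (kgM₂Y n ℓ hs v R' ρ q W N) ≤
      ((N' : ℤ) + 2) * |v| + 2 * n + W + ((N' : ℤ) + 1) * R' + (2 * ((n : ℤ) + |v|) + kgDec₁Y n R' ρ) +
        ((((kgM₁Y n v R' ρ W N' : ℕ) : ℤ)) + (kgM₂Y n ℓ hs v R' ρ q W N' : ℕ) + 2) * ((R' : ℤ) + ρ + |v|) + R' := by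
  have hE := (H.kgE₁Y_spec N).2.2
  have hsum : ((kgWm₂Y n v R' ρ W N : ℕ) : ℤ) + (kgWp₂Y n v R' ρ W N : ℕ) = (kgE₁Y n v R' ρ W N : ℕ) := by
    exact_mod_cast kgWm₂Y_add_kgWp₂Y (n := n) (v := v) (R' := R') (ρ := ρ) (W := W) N
  have hm₁ : ((kgM₁Y n v R' ρ W N : ℕ) : ℤ) ≤ (kgM₁Y n v R' ρ W N' : ℕ) := by exact_mod_cast H.kgM₁Y_mono h
  have hm₂ : ((kgM₂Y n ℓ hs v R' ρ q W N : ℕ) : ℤ) ≤ (kgM₂Y n ℓ hs v R' ρ q W N' : ℕ) := by exact_mod_cast H.kgM₂Y_mono h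
  unfold kgZY₀
  have hN : (N : ℤ) ≤ N' := by exact_mod_cast h
  have hR : (0 : ℤ) ≤ R' := by positivity
  have hρ : (0 : ℤ) ≤ ρ := by positivity
  have hv : (0 : ℤ) ≤ |v| := abs_nonneg _
  nlinarith

/-- **The schedule length `N + 1 + (m₁Y+1) + (m₂Y+1)` is monotone in `N`.** [this work] -/
theorem KGYRows.kgSchedLenY_mono (H : KGYRows n ℓ hs v R' ρ q W) {N N' : ℕ} (h : N ≤ N') :
    N + 1 + (kgM₁Y n v R' ρ W N + 1) + (kgM₂Y n ℓ hs v R' ρ q W N + 1) ≤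
      N' + 1 + (kgM₁Y n v R' ρ W N' + 1) + (kgM₂Y n ℓ hs v R' ρ q W N' + 1) := by
  have := H.kgM₁Y_mono h
  have := H.kgM₂Y_mono h
  omega

end KGYMono

end Skelφ

end Summit.CriticalPhenomena.PercolationContinuityZ3.Theorems.Transplant
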